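import Summits.Ventures.PercRepro.RankLevelSetLevelNineGXArithAA
import Summits.Ventures.PercRepro.RankLevelSetLevelNineGXArithAB
import Summits.Ventures.PercRepro.RankLevelSetLevelNineGXArithAC
import Summits.Ventures.PercRepro.RankLevelSetLevelNineGXArithAD
import Summits.Ventures.PercRepro.RankLevelSetLevelNineGXArithAE
import Summits.Ventures.PercRepro.RankLevelSetLevelNineGXArithAF
import Summits.Ventures.PercRepro.RankLevelSetLevelNineGXArithAG
import Summits.Ventures.PercRepro.RankLevelSetLevelNineGXArithAH
import Summits.Ventures.PercRepro.RankLevelSetLevelNineGXArithAI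
import Summits.Ventures.PercRepro.RankLevelSetLevelNineGXTailsA
import Summits.Ventures.PercRepro.RankLevelSetLevelNineGXTailsB
import Summits.Ventures.PercRepro.RankLevelSetLevelNineGXTailsC

/-!
# PercRepro — THE LEVEL-`9` DISPATCHER OF THE GX CHAIN AT BASE `237`, QUARTER ZA: the per-corank form `(c₁, c₂)`, `(P_d^gx)`
and the `Y`-tail for `10 ≤ d ≤ 80` in one existential statement (p2, gen 35; a feeder for S4 — the top of the `q = 9` window).
The certificates of RankLevelSetLevelNineGXArith{…} and the tail bases of RankLevelSetLevelNineGXTails{…} lifted by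
`mul_tailG_nine_le_of_base`. Axioms: standard.
-/

set_option exponentiation.threshold 1024

namespace PercRepro

namespace ThmN

set_option maxHeartbeats 4000000 in
/-- The quarter `10 ≤ d ≤ 80` of `gx_form_nine`. -/
theorem gx_form_nine_ZA (d : ℕ) (hd1 : 10 ≤ d) (hd2 : d ≤ 80) (p : ℕ) (hp : 237 ≤ p) (n : ℕ) (hn : 237 + d ≤ n) :
    ∃ c₁ c₂ : ℕ, 0 < c₂ ∧ c₂ < c₁ ∧
    ((c₁ : ℕ) : ℚ) * ((((p + d).choose 9 : ℕ) : ℚ) + (∑ j ∈ Finset.range (d - 9), ((Nat.choose (min 309 (max ((d + min 151 d) / 2 + 1) (min 150 (d - 1) + 2) - 2)) j : ℕ) : ℚ) / (((j + 1) + 3 * (j + 1).choose 2 + 3 * (j + 1).choose 3 + 2 * (j + 1).choose 4 : ℕ) : ℚ)) *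
      (((d * (d + 1) / 2 : ℕ) : ℚ) * ((p + d).choose 7 : ℚ) + ((d * (d + 1) * (d + 2) / 3 : ℕ) : ℚ) * ((p + d).choose 6 : ℚ) + (((d + 4).choose 5 : ℕ) : ℚ) * ((p + d).choose 5 : ℚ) + (((d + 5).choose 6 : ℕ) : ℚ) * ((p + d).choose 4 : ℚ) + (((d + 6).choose 7 : ℕ) : ℚ) * ((p + d).choose 3 : ℚ) + (((d + 7).choose 8 : ℕ) : ℚ) * ((p + d).choose 2 : ℚ) + (((d + 8).choose 9 : ℕ) : ℚ) * (p + d : ℚ) + (((d + 9).choose 10 : ℕ) : ℚ)) +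
      (2 : ℚ) ^ (min 319 (9 + d))) ≤
      ((c₂ : ℕ) : ℚ) * 2 ^ (d - 9) * (((p + 9).choose 9 : ℕ) : ℚ) ∧
      c₁ * (n.choose 9 * 2 ^ (min 310 d) + n.choose 8 * 2 ^ 151 + n.choose 7 * 2 ^ 72 + n.choose 6 * 2 ^ 33 + n.choose 5 * 2 ^ 14 + n.choose 4 * 2 ^ 6 + n.choose 3 * 2 ^ 3 + n.choose 2 * 2 + n + 1 + ∑ j ∈ Finset.range (d + 1), n.choose j) ≤ (c₁ - c₂) * 2 ^ n := by
  interval_cases d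
  · exact ⟨3, 2, by norm_num, by norm_num, level_nine_poly_gx_10 p hp, mul_tailG_nine_le_of_base 3 1 10 247 (by norm_num) gx_tail_nine_base_10 n (by omega)⟩
  · exact ⟨2, 1, by norm_num, by norm_num, level_nine_poly_gx_11 p hp, mul_tailG_nine_le_of_base 2 1 11 248 (by norm_num) gx_tail_nine_base_11 n (by omega)⟩
  · exact ⟨2, 1, by norm_num, by norm_num, level_nine_poly_gx_12 p hp, mul_tailG_nine_le_of_base 2 1 12 249 (by norm_num) gx_tail_nine_base_12 n (by omega)⟩
  · exact ⟨2, 1, by norm_num, by norm_num, level_nine_poly_gx_13 p hp, mul_tailG_nine_le_of_base 2 1 13 250 (by norm_num) gx_tail_nine_base_13 n (by omega)⟩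
  · exact ⟨2, 1, by norm_num, by norm_num, level_nine_poly_gx_14 p hp, mul_tailG_nine_le_of_base 2 1 14 251 (by norm_num) gx_tail_nine_base_14 n (by omega)⟩
  · exact ⟨2, 1, by norm_num, by norm_num, level_nine_poly_gx_15 p hp, mul_tailG_nine_le_of_base 2 1 15 252 (by norm_num) gx_tail_nine_base_15 n (by omega)⟩
  · exact ⟨2, 1, by norm_num, by norm_num, level_nine_poly_gx_16 p hp, mul_tailG_nine_le_of_base 2 1 16 253 (by norm_num) gx_tail_nine_base_16 n (by omega)⟩
  · exact ⟨2, 1, by norm_num, by norm_num, level_nine_poly_gx_17 p hp, mul_tailG_nine_le_of_base 2 1 17 254 (by norm_num) gx_tail_nine_base_17 n (by omega)⟩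
  · exact ⟨2, 1, by norm_num, by norm_num, level_nine_poly_gx_18 p hp, mul_tailG_nine_le_of_base 2 1 18 255 (by norm_num) gx_tail_nine_base_18 n (by omega)⟩
  · exact ⟨2, 1, by norm_num, by norm_num, level_nine_poly_gx_19 p hp, mul_tailG_nine_le_of_base 2 1 19 256 (by norm_num) gx_tail_nine_base_19 n (by omega)⟩
  · exact ⟨2, 1, by norm_num, by norm_num, level_nine_poly_gx_20 p hp, mul_tailG_nine_le_of_base 2 1 20 257 (by norm_num) gx_tail_nine_base_20 n (by omega)⟩
  · exact ⟨2, 1, by norm_num, by norm_num, level_nine_poly_gx_21 p hp, mul_tailG_nine_le_of_base 2 1 21 258 (by norm_num) gx_tail_nine_base_21 n (by omega)⟩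
  · exact ⟨2, 1, by norm_num, by norm_num, level_nine_poly_gx_22 p hp, mul_tailG_nine_le_of_base 2 1 22 259 (by norm_num) gx_tail_nine_base_22 n (by omega)⟩
  · exact ⟨2, 1, by norm_num, by norm_num, level_nine_poly_gx_23 p hp, mul_tailG_nine_le_of_base 2 1 23 260 (by norm_num) gx_tail_nine_base_23 n (by omega)⟩
  · exact ⟨2, 1, by norm_num, by norm_num, level_nine_poly_gx_24 p hp, mul_tailG_nine_le_of_base 2 1 24 261 (by norm_num) gx_tail_nine_base_24 n (by omega)⟩
  · exact ⟨2, 1, by norm_num, by norm_num, level_nine_poly_gx_25 p hp, mul_tailG_nine_le_of_base 2 1 25 262 (by norm_num) gx_tail_nine_base_25 n (by omega)⟩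
  · exact ⟨2, 1, by norm_num, by norm_num, level_nine_poly_gx_26 p hp, mul_tailG_nine_le_of_base 2 1 26 263 (by norm_num) gx_tail_nine_base_26 n (by omega)⟩
  · exact ⟨2, 1, by norm_num, by norm_num, level_nine_poly_gx_27 p hp, mul_tailG_nine_le_of_base 2 1 27 264 (by norm_num) gx_tail_nine_base_27 n (by omega)⟩
  · exact ⟨2, 1, by norm_num, by norm_num, level_nine_poly_gx_28 p hp, mul_tailG_nine_le_of_base 2 1 28 265 (by norm_num) gx_tail_nine_base_28 n (by omega)⟩
  · exact ⟨2, 1, by norm_num, by norm_num, level_nine_poly_gx_29 p hp, mul_tailG_nine_le_of_base 2 1 29 266 (by norm_num) gx_tail_nine_base_29 n (by omega)⟩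
  · exact ⟨2, 1, by norm_num, by norm_num, level_nine_poly_gx_30 p hp, mul_tailG_nine_le_of_base 2 1 30 267 (by norm_num) gx_tail_nine_base_30 n (by omega)⟩
  · exact ⟨2, 1, by norm_num, by norm_num, level_nine_poly_gx_31 p hp, mul_tailG_nine_le_of_base 2 1 31 268 (by norm_num) gx_tail_nine_base_31 n (by omega)⟩
  · exact ⟨2, 1, by norm_num, by norm_num, level_nine_poly_gx_32 p hp, mul_tailG_nine_le_of_base 2 1 32 269 (by norm_num) gx_tail_nine_base_32 n (by omega)⟩
  · exact ⟨2, 1, by norm_num, by norm_num, level_nine_poly_gx_33 p hp, mul_tailG_nine_le_of_base 2 1 33 270 (by norm_num) gx_tail_nine_base_33 n (by omega)⟩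
  · exact ⟨2, 1, by norm_num, by norm_num, level_nine_poly_gx_34 p hp, mul_tailG_nine_le_of_base 2 1 34 271 (by norm_num) gx_tail_nine_base_34 n (by omega)⟩
  · exact ⟨2, 1, by norm_num, by norm_num, level_nine_poly_gx_35 p hp, mul_tailG_nine_le_of_base 2 1 35 272 (by norm_num) gx_tail_nine_base_35 n (by omega)⟩
  · exact ⟨2, 1, by norm_num, by norm_num, level_nine_poly_gx_36 p hp, mul_tailG_nine_le_of_base 2 1 36 273 (by norm_num) gx_tail_nine_base_36 n (by omega)⟩
  · exact ⟨2, 1, by norm_num, by norm_num, level_nine_poly_gx_37 p hp, mul_tailG_nine_le_of_base 2 1 37 274 (by norm_num) gx_tail_nine_base_37 n (by omega)⟩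
  · exact ⟨2, 1, by norm_num, by norm_num, level_nine_poly_gx_38 p hp, mul_tailG_nine_le_of_base 2 1 38 275 (by norm_num) gx_tail_nine_base_38 n (by omega)⟩
  · exact ⟨2, 1, by norm_num, by norm_num, level_nine_poly_gx_39 p hp, mul_tailG_nine_le_of_base 2 1 39 276 (by norm_num) gx_tail_nine_base_39 n (by omega)⟩
  · exact ⟨2, 1, by norm_num, by norm_num, level_nine_poly_gx_40 p hp, mul_tailG_nine_le_of_base 2 1 40 277 (by norm_num) gx_tail_nine_base_40 n (by omega)⟩
  · exact ⟨2, 1, by norm_num, by norm_num, level_nine_poly_gx_41 p hp, mul_tailG_nine_le_of_base 2 1 41 278 (by norm_num) gx_tail_nine_base_41 n (by omega)⟩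
  · exact ⟨2, 1, by norm_num, by norm_num, level_nine_poly_gx_42 p hp, mul_tailG_nine_le_of_base 2 1 42 279 (by norm_num) gx_tail_nine_base_42 n (by omega)⟩
  · exact ⟨2, 1, by norm_num, by norm_num, level_nine_poly_gx_43 p hp, mul_tailG_nine_le_of_base 2 1 43 280 (by norm_num) gx_tail_nine_base_43 n (by omega)⟩
  · exact ⟨2, 1, by norm_num, by norm_num, level_nine_poly_gx_44 p hp, mul_tailG_nine_le_of_base 2 1 44 281 (by norm_num) gx_tail_nine_base_44 n (by omega)⟩
  · exact ⟨2, 1, by norm_num, by norm_num, level_nine_poly_gx_45 p hp, mul_tailG_nine_le_of_base 2 1 45 282 (by norm_num) gx_tail_nine_base_45 n (by omega)⟩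
  · exact ⟨2, 1, by norm_num, by norm_num, level_nine_poly_gx_46 p hp, mul_tailG_nine_le_of_base 2 1 46 283 (by norm_num) gx_tail_nine_base_46 n (by omega)⟩
  · exact ⟨2, 1, by norm_num, by norm_num, level_nine_poly_gx_47 p hp, mul_tailG_nine_le_of_base 2 1 47 284 (by norm_num) gx_tail_nine_base_47 n (by omega)⟩
  · exact ⟨2, 1, by norm_num, by norm_num, level_nine_poly_gx_48 p hp, mul_tailG_nine_le_of_base 2 1 48 285 (by norm_num) gx_tail_nine_base_48 n (by omega)⟩
  · exact ⟨2, 1, by norm_num, by norm_num, level_nine_poly_gx_49 p hp, mul_tailG_nine_le_of_base 2 1 49 286 (by norm_num) gx_tail_nine_base_49 n (by omega)⟩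
  · exact ⟨2, 1, by norm_num, by norm_num, level_nine_poly_gx_50 p hp, mul_tailG_nine_le_of_base 2 1 50 287 (by norm_num) gx_tail_nine_base_50 n (by omega)⟩
  · exact ⟨2, 1, by norm_num, by norm_num, level_nine_poly_gx_51 p hp, mul_tailG_nine_le_of_base 2 1 51 288 (by norm_num) gx_tail_nine_base_51 n (by omega)⟩
  · exact ⟨2, 1, by norm_num, by norm_num, level_nine_poly_gx_52 p hp, mul_tailG_nine_le_of_base 2 1 52 289 (by norm_num) gx_tail_nine_base_52 n (by omega)⟩
  · exact ⟨2, 1, by norm_num, by norm_num, level_nine_poly_gx_53 p hp, mul_tailG_nine_le_of_base 2 1 53 290 (by norm_num) gx_tail_nine_base_53 n (by omega)⟩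
  · exact ⟨2, 1, by norm_num, by norm_num, level_nine_poly_gx_54 p hp, mul_tailG_nine_le_of_base 2 1 54 291 (by norm_num) gx_tail_nine_base_54 n (by omega)⟩
  · exact ⟨2, 1, by norm_num, by norm_num, level_nine_poly_gx_55 p hp, mul_tailG_nine_le_of_base 2 1 55 292 (by norm_num) gx_tail_nine_base_55 n (by omega)⟩
  · exact ⟨2, 1, by norm_num, by norm_num, level_nine_poly_gx_56 p hp, mul_tailG_nine_le_of_base 2 1 56 293 (by norm_num) gx_tail_nine_base_56 n (by omega)⟩
  · exact ⟨2, 1, by norm_num, by norm_num, level_nine_poly_gx_57 p hp, mul_tailG_nine_le_of_base 2 1 57 294 (by norm_num) gx_tail_nine_base_57 n (by omega)⟩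
  · exact ⟨2, 1, by norm_num, by norm_num, level_nine_poly_gx_58 p hp, mul_tailG_nine_le_of_base 2 1 58 295 (by norm_num) gx_tail_nine_base_58 n (by omega)⟩
  · exact ⟨2, 1, by norm_num, by norm_num, level_nine_poly_gx_59 p hp, mul_tailG_nine_le_of_base 2 1 59 296 (by norm_num) gx_tail_nine_base_59 n (by omega)⟩
  · exact ⟨2, 1, by norm_num, by norm_num, level_nine_poly_gx_60 p hp, mul_tailG_nine_le_of_base 2 1 60 297 (by norm_num) gx_tail_nine_base_60 n (by omega)⟩
  · exact ⟨2, 1, by norm_num, by norm_num, level_nine_poly_gx_61 p hp, mul_tailG_nine_le_of_base 2 1 61 298 (by norm_num) gx_tail_nine_base_61 n (by omega)⟩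
  · exact ⟨2, 1, by norm_num, by norm_num, level_nine_poly_gx_62 p hp, mul_tailG_nine_le_of_base 2 1 62 299 (by norm_num) gx_tail_nine_base_62 n (by omega)⟩
  · exact ⟨2, 1, by norm_num, by norm_num, level_nine_poly_gx_63 p hp, mul_tailG_nine_le_of_base 2 1 63 300 (by norm_num) gx_tail_nine_base_63 n (by omega)⟩
  · exact ⟨2, 1, by norm_num, by norm_num, level_nine_poly_gx_64 p hp, mul_tailG_nine_le_of_base 2 1 64 301 (by norm_num) gx_tail_nine_base_64 n (by omega)⟩
  · exact ⟨2, 1, by norm_num, by norm_num, level_nine_poly_gx_65 p hp, mul_tailG_nine_le_of_base 2 1 65 302 (by norm_num) gx_tail_nine_base_65 n (by omega)⟩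
  · exact ⟨2, 1, by norm_num, by norm_num, level_nine_poly_gx_66 p hp, mul_tailG_nine_le_of_base 2 1 66 303 (by norm_num) gx_tail_nine_base_66 n (by omega)⟩
  · exact ⟨2, 1, by norm_num, by norm_num, level_nine_poly_gx_67 p hp, mul_tailG_nine_le_of_base 2 1 67 304 (by norm_num) gx_tail_nine_base_67 n (by omega)⟩
  · exact ⟨2, 1, by norm_num, by norm_num, level_nine_poly_gx_68 p hp, mul_tailG_nine_le_of_base 2 1 68 305 (by norm_num) gx_tail_nine_base_68 n (by omega)⟩
  · exact ⟨2, 1, by norm_num, by norm_num, level_nine_poly_gx_69 p hp, mul_tailG_nine_le_of_base 2 1 69 306 (by norm_num) gx_tail_nine_base_69 n (by omega)⟩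
  · exact ⟨2, 1, by norm_num, by norm_num, level_nine_poly_gx_70 p hp, mul_tailG_nine_le_of_base 2 1 70 307 (by norm_num) gx_tail_nine_base_70 n (by omega)⟩
  · exact ⟨2, 1, by norm_num, by norm_num, level_nine_poly_gx_71 p hp, mul_tailG_nine_le_of_base 2 1 71 308 (by norm_num) gx_tail_nine_base_71 n (by omega)⟩
  · exact ⟨2, 1, by norm_num, by norm_num, level_nine_poly_gx_72 p hp, mul_tailG_nine_le_of_base 2 1 72 309 (by norm_num) gx_tail_nine_base_72 n (by omega)⟩
  · exact ⟨2, 1, by norm_num, by norm_num, level_nine_poly_gx_73 p hp, mul_tailG_nine_le_of_base 2 1 73 310 (by norm_num) gx_tail_nine_base_73 n (by omega)⟩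
  · exact ⟨2, 1, by norm_num, by norm_num, level_nine_poly_gx_74 p hp, mul_tailG_nine_le_of_base 2 1 74 311 (by norm_num) gx_tail_nine_base_74 n (by omega)⟩
  · exact ⟨2, 1, by norm_num, by norm_num, level_nine_poly_gx_75 p hp, mul_tailG_nine_le_of_base 2 1 75 312 (by norm_num) gx_tail_nine_base_75 n (by omega)⟩
  · exact ⟨2, 1, by norm_num, by norm_num, level_nine_poly_gx_76 p hp, mul_tailG_nine_le_of_base 2 1 76 313 (by norm_num) gx_tail_nine_base_76 n (by omega)⟩
  · exact ⟨2, 1, by norm_num, by norm_num, level_nine_poly_gx_77 p hp, mul_tailG_nine_le_of_base 2 1 77 314 (by norm_num) gx_tail_nine_base_77 n (by omega)⟩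
  · exact ⟨2, 1, by norm_num, by norm_num, level_nine_poly_gx_78 p hp, mul_tailG_nine_le_of_base 2 1 78 315 (by norm_num) gx_tail_nine_base_78 n (by omega)⟩
  · exact ⟨2, 1, by norm_num, by norm_num, level_nine_poly_gx_79 p hp, mul_tailG_nine_le_of_base 2 1 79 316 (by norm_num) gx_tail_nine_base_79 n (by omega)⟩
  · exact ⟨2, 1, by norm_num, by norm_num, level_nine_poly_gx_80 p hp, mul_tailG_nine_le_of_base 2 1 80 317 (by norm_num) gx_tail_nine_base_80 n (by omega)⟩

end ThmN

end PercRepro
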